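import Mathlib.AlgebraicGeometry.Modules.Sheaf
import Mathlib.Algebra.Category.ModuleCat.Presheaf.Monoidal
import Mathlib.Algebra.Category.ModuleCat.Presheaf.Sheafification
import Mathlib.CategoryTheory.Monoidal.Preadditive
import HarnessLib

/-!
# The tensor product of `𝒪_X`-modules on a scheme

The Stacks Project, Modules, Section 17.16 (Tag 01CA), verbatim: "Let `(X, 𝒪_X)` be a ringed space
and let `ℱ` and `𝒢` be `𝒪_X`-modules. We define first the tensor product presheaf `ℱ ⊗_{p,𝒪_X} 𝒢`
as the rule which assigns to `U ⊂ X` open the `𝒪_X(U)`-module `ℱ(U) ⊗_{𝒪_X(U)} 𝒢(U)`. Having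
defined this we define the tensor product sheaf as the sheafification of the above:
`ℱ ⊗_{𝒪_X} 𝒢 = (ℱ ⊗_{p,𝒪_X} 𝒢)^#` […] functorial in `ℱ`, `𝒢`."

Mathlib (pin v4.32.0) has both halves but not their combination: the monoidal structure on
PRESHEAVES of modules over a presheaf of commutative rings
(`PresheafOfModules.monoidalCategory`, objectwise `M(U) ⊗_{R(U)} N(U)`) and the sheafification
of presheaves of modules (`PresheafOfModules.sheafification`, used by Mathlib itself to make
`X.Modules ⥤ X.PresheafOfModules` a right adjoint). This file assembles them for a scheme `X`
(Mathlib's abelian category `X.Modules` of ALL sheaves of `𝒪_X`-modules):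

* `CommRingedPresheafOfModules X` — `X.PresheafOfModules`, retyped over
  `X.sheaf.obj ⋙ forget₂ CommRingCat RingCat` (definitionally the same category) so that the
  monoidal instance applies; `toCommRingedPresheaf M`, `homToCommRingedPresheaf φ`;
* `modulesSheafify X : X.PresheafOfModules ⥤ X.Modules` with `modulesSheafifyAdjunction` (a left
  adjoint: preserves zero objects);
* `tensorObj M N = M ⊗_{𝒪_X} N`, `tensorMap f g` (a bifunctor: `tensorMap_id`, `tensorMap_comp`),
  `tensorMapIso`, `isZero_tensorObj_of_isZero` (`M ⊗ 0 = 0`), and the tensor powers `tensorPow M m`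
  (`M^{⊗0} = 𝒪_X`).

Not here (deliberately): the associator/unitors/symmetry and the full `MonoidalCategory X.Modules`
instance (needs the compatibility of sheafification with the presheaf tensor product, Tag 01CA
"Lemma 16.2"; a construction of some size, not needed by the present consumers, which only use
`Extⁿ(E, E ⊗ I)` and its functoriality), stalks / quasi-coherence of the tensor product, and the
identification `E ⊗ 𝒪_X ≅ E`. Requested through `defn-VectorBundleExtensionObstruction`
(coefficients `E₀ ⊗ 𝓘` of the obstruction groups of `Deformation/VectorBundleLifting`).

Mathlib searched (pin): `PresheafOfModules.monoidalCategory`, `PresheafOfModules.sheafification`,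
`PresheafOfModules.sheafificationAdjunction`, `SheafOfModules.pullback` (monoidal: no),
`Scheme.Modules` (no tensor product), `MonoidalCategory (SheafOfModules _)` (none).

## References

* [StacksProject] The Stacks Project, Tag 01CA (Modules, §16 Tensor product).
-/

noncomputable section

open CategoryTheory CategoryTheory.Limits AlgebraicGeometry MonoidalCategory

universe u

namespace Literature.AlgebraicGeometry.Modules

section TensorProduct

variable (X : Scheme.{u})

/-- Presheaves of `𝒪_X`-modules on a scheme `X`, typed over the structure presheaf written as
`X.sheaf.obj ⋙ forget₂ CommRingCat RingCat` (definitionally Mathlib's `X.PresheafOfModules`); in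
this form Mathlib's monoidal structure on presheaves of modules over a presheaf of COMMUTATIVE
rings (`PresheafOfModules.monoidalCategory`: `(M ⊗ N)(U) = M(U) ⊗_{𝒪_X(U)} N(U)`) applies.
[cite: StacksProject, Tag 01CA] -/
abbrev CommRingedPresheafOfModules : Type (u + 1) :=
  PresheafOfModules.{u} (X.sheaf.obj ⋙ forget₂ CommRingCat RingCat)

variable {X} in
/-- The underlying presheaf of modules of an `𝒪_X`-module, as an object of
`CommRingedPresheafOfModules X`. [folklore] -/
abbrev toCommRingedPresheaf (M : X.Modules) : CommRingedPresheafOfModules X :=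
  M.val

variable {X} in
/-- The underlying morphism of presheaves of modules of a morphism of `𝒪_X`-modules.
[folklore] -/
abbrev homToCommRingedPresheaf {M N : X.Modules} (φ : M ⟶ N) :
    toCommRingedPresheaf M ⟶ toCommRingedPresheaf N :=
  φ.val

/-- The sheafification functor from presheaves of `𝒪_X`-modules to `𝒪_X`-modules (Mathlib's
`PresheafOfModules.sheafification` along `𝟙 𝒪_X`, retyped with target `X.Modules`).
[cite: StacksProject, Tag 01CA] -/
def modulesSheafify : X.PresheafOfModules ⥤ X.Modules :=
  PresheafOfModules.sheafification (𝟙 X.ringCatSheaf.obj)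

/-- Sheafification is left adjoint to the forgetful functor `X.Modules ⥤ X.PresheafOfModules`
(Mathlib's `PresheafOfModules.sheafificationAdjunction`). [folklore] -/
def modulesSheafifyAdjunction : modulesSheafify X ⊣ Scheme.Modules.toPresheafOfModules X :=
  PresheafOfModules.sheafificationAdjunction (𝟙 X.ringCatSheaf.obj)

/-- Sheafification of presheaves of `𝒪_X`-modules is a left adjoint (hence preserves zero
morphisms and zero objects). [folklore] -/
instance isLeftAdjoint_modulesSheafify : (modulesSheafify X).IsLeftAdjoint :=
  (modulesSheafifyAdjunction X).isLeftAdjoint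

variable {X}

/-- **The tensor product `M ⊗_{𝒪_X} N` of two `𝒪_X`-modules**: the sheafification of the
presheaf `U ↦ M(U) ⊗_{𝒪_X(U)} N(U)` ("we define the tensor product sheaf as the sheafification
of the above: `F ⊗_{𝒪_X} G = (F ⊗_{p,𝒪_X} G)^#`"). Mathlib (pin v4.32.0) has the monoidal
structure on PRESHEAVES of modules and the sheafification of presheaves of modules, but not
their combination; this is it. [cite: StacksProject, Tag 01CA] -/
def tensorObj (M N : X.Modules) : X.Modules :=
  (modulesSheafify X).obj
    ((toCommRingedPresheaf M ⊗ toCommRingedPresheaf N : CommRingedPresheafOfModules X))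

/-- Functoriality of `M ⊗_{𝒪_X} N` in both variables ("functorial in `F`, `G`"): the
sheafification of `f(U) ⊗ g(U)`. [cite: StacksProject, Tag 01CA] -/
def tensorMap {M M' N N' : X.Modules} (f : M ⟶ M') (g : N ⟶ N') :
    tensorObj M N ⟶ tensorObj M' N' :=
  (modulesSheafify X).map
    ((homToCommRingedPresheaf f ⊗ₘ homToCommRingedPresheaf g :
      (toCommRingedPresheaf M ⊗ toCommRingedPresheaf N : CommRingedPresheafOfModules X) ⟶
        (toCommRingedPresheaf M' ⊗ toCommRingedPresheaf N')))

/-- `𝟙 ⊗ 𝟙 = 𝟙`. [folklore] -/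
@[simp]
theorem tensorMap_id (M N : X.Modules) : tensorMap (𝟙 M) (𝟙 N) = 𝟙 (tensorObj M N) := by
  simp only [tensorMap]
  have hM : homToCommRingedPresheaf (𝟙 M) = 𝟙 (toCommRingedPresheaf M) := rfl
  have hN : homToCommRingedPresheaf (𝟙 N) = 𝟙 (toCommRingedPresheaf N) := rfl
  rw [hM, hN, MonoidalCategory.id_tensorHom_id]
  exact (modulesSheafify X).map_id _

/-- `(f ≫ f') ⊗ (g ≫ g') = (f ⊗ g) ≫ (f' ⊗ g')`. [folklore] -/
theorem tensorMap_comp {M M' M'' N N' N'' : X.Modules} (f : M ⟶ M') (f' : M' ⟶ M'')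
    (g : N ⟶ N') (g' : N' ⟶ N'') :
    tensorMap (f ≫ f') (g ≫ g') = tensorMap f g ≫ tensorMap f' g' := by
  simp only [tensorMap]
  have hf : homToCommRingedPresheaf (f ≫ f') =
      homToCommRingedPresheaf f ≫ homToCommRingedPresheaf f' := rfl
  have hg : homToCommRingedPresheaf (g ≫ g') =
      homToCommRingedPresheaf g ≫ homToCommRingedPresheaf g' := rfl
  rw [hf, hg, ← MonoidalCategory.tensorHom_comp_tensorHom]
  exact (modulesSheafify X).map_comp _ _

/-- `M ⊗_{𝒪_X} –` and `– ⊗_{𝒪_X} N` carry isomorphisms to isomorphisms. [folklore] -/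
def tensorMapIso {M M' N N' : X.Modules} (e : M ≅ M') (e' : N ≅ N') :
    tensorObj M N ≅ tensorObj M' N' where
  hom := tensorMap e.hom e'.hom
  inv := tensorMap e.inv e'.inv
  hom_inv_id := by rw [← tensorMap_comp, e.hom_inv_id, e'.hom_inv_id, tensorMap_id]
  inv_hom_id := by rw [← tensorMap_comp, e.inv_hom_id, e'.inv_hom_id, tensorMap_id]

/-- `(tensorMapIso e e').hom = tensorMap e.hom e'.hom`. [folklore] -/
@[simp]
theorem tensorMapIso_hom {M M' N N' : X.Modules} (e : M ≅ M') (e' : N ≅ N') :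
    (tensorMapIso e e').hom = tensorMap e.hom e'.hom :=
  rfl

/-- `(tensorMapIso e e').inv = tensorMap e.inv e'.inv`. [folklore] -/
@[simp]
theorem tensorMapIso_inv {M M' N N' : X.Modules} (e : M ≅ M') (e' : N ≅ N') :
    (tensorMapIso e e').inv = tensorMap e.inv e'.inv :=
  rfl

/-- The presheaf tensor product with a zero presheaf of modules is zero
(`M(U) ⊗ 0 = 0`). [folklore] -/
theorem isZero_presheafTensorObj_of_isZero {C : Type*} [Category C]
    {R : Cᵒᵖ ⥤ CommRingCat.{u}} (M N : PresheafOfModules.{u} (R ⋙ forget₂ _ _))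
    (hN : IsZero N) : IsZero (M ⊗ N) := by
  rw [IsZero.iff_id_eq_zero, ← MonoidalCategory.whiskerLeft_id, hN.eq_of_src (𝟙 N) 0]
  apply PresheafOfModules.hom_ext
  intro U
  change (𝟙 (M.obj U)) ⊗ₘ (0 : N.obj U ⟶ N.obj U) = 0
  exact MonoidalPreadditive.tensor_zero _

/-- `M ⊗_{𝒪_X} N = 0` when `N = 0` (sheafification preserves zero objects). [folklore] -/
theorem isZero_tensorObj_of_isZero (M N : X.Modules) (hN : IsZero N) :
    IsZero (tensorObj M N) := by
  apply (modulesSheafify X).map_isZero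
  apply isZero_presheafTensorObj_of_isZero (R := X.sheaf.obj)
  exact (Scheme.Modules.toPresheafOfModules X).map_isZero hN

/-- Iterated tensor powers `M^{⊗ m}` of an `𝒪_X`-module (`M^{⊗ 0} = 𝒪_X`,
`M^{⊗ (m+1)} = M^{⊗ m} ⊗ M`). [folklore] -/
def tensorPow (M : X.Modules) : ℕ → X.Modules
  | 0 => SheafOfModules.unit X.ringCatSheaf
  | m + 1 => tensorObj (tensorPow M m) M

/-- `M^{⊗ 0} = 𝒪_X`. [folklore] -/
@[simp] theorem tensorPow_zero (M : X.Modules) :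
    tensorPow M 0 = SheafOfModules.unit X.ringCatSheaf := rfl

/-- `M^{⊗ (m+1)} = M^{⊗ m} ⊗ M`. [folklore] -/
@[simp] theorem tensorPow_succ (M : X.Modules) (m : ℕ) :
    tensorPow M (m + 1) = tensorObj (tensorPow M m) M := rfl

end TensorProduct

end Literature.AlgebraicGeometry.Modules

end
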